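import Summits.Ventures.DiscreteObjects.Hadamard.WilliamsonSequences167Iff668

/-!
# Williamson's product theorem (1944) for Williamson sequences of odd length (kernel), and the normalised form of the
# classical-Williamson census line at 668

Framing: lottery ticket; floor = certified bounds/negative ranges.

Cell pub-namedobj (venture DiscreteObjects), target (H), hadamard gen 23.  REPLICATION, with our own elementary proof, of
WILLIAMSON'S THEOREM [Williamson, Duke Math. J. 11 (1944) 65–81; Seberry–Yamada, *Hadamard Matrices* (Wiley 2020) §3.2,
Lemma 3.1; Hall, *Combinatorial Theory* §14.2]: if `a, b, c, d` are SYMMETRIC `±1` sequences on `ℤ/n`, `n` ODD, with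
`PAF_a + PAF_b + PAF_c + PAF_d = 0` off `0` (Williamson sequences — the first rows of Williamson matrices), then for every
`s ≠ 0` exactly three of `a_s, b_s, c_s, d_s` have the same sign once `a_0 = b_0 = c_0 = d_0 = 1`; invariantly,
**`a_s b_s c_s d_s = −a_0 b_0 c_0 d_0`** (`williamson_product_theorem`).  This is the reduction behind every Williamson search
(Baumert–Hall 1965 onwards) and the census STRUCTURE statement for the classical-Williamson line of gen 22
(`|N(⟨σ₁₆₇⟩):±⟨σ₁₆₇⟩| = 8 ⇔ Williamson sequences of length 167`): **`hadamard668_normalizer_index_eight_williamson_normalised`**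
— that hypothesis yields NORMALISED Williamson sequences of length `167` (`a_0 = b_0 = c_0 = d_0 = 1`) with
`a_s b_s c_s d_s = −1` for all `166` non-zero `s`.
Proof (the textbook argument, in sequence language).  With the `−1`-indicator `N_x(i) = (1 − x_i)/2 ∈ {0,1}`:
`PAF_x(t) = n − 4 K_x + 4 R_x(t)`, `K_x = Σ_i N_x(i)`, `R_x(t) = Σ_i N_x(i) N_x(i+t)` (`paf_eq_indicator`), so the hypothesis at
the shift `t = 2s ≠ 0` (`n` odd) gives `Σ_X R_X(2s) = Σ_X K_X − n` in `ℤ`.  Parities (n odd, x symmetric): `K_x ≡ N_x(0)` (pair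
`i ↔ −i`, `indicator_sum_cast`) and `R_x(2s) ≡ N_x(s)` (pair `i ↔ −i − 2s`, unique fixed point `−s`, `indicator_corr_cast`)
`(mod 2)`, both by `Finset.sum_involution` in `ZMod 2`; hence `Σ_X N_X(s) ≡ Σ_X N_X(0) + 1 (mod 2)`, i.e. an odd number of
`−1`'s among the eight values `a_s, …, d_0`, i.e. the product identity (`prod_one_sub_two_mul`).
Ours (the theorem is the cited classical one); no `sorry`, no definitions, default heartbeats.
-/

namespace Summit.Ventures.DiscreteObjects.Hadamard

open Finset BigOperators Matrix

open Literature.Combinatorics.Designs.GoethalsSeidel (IsHadamardMatrix)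
open Literature.Combinatorics.Designs.LegendrePairs (PAF IsPM)

/-! ### tools: the `−1`-indicator `N_x(i) = (1 − x i)/2` of a `±1` sequence -/

section indicator
variable {n : ℕ} [NeZero n] (x : ZMod n → ℤ) (hx : IsPM x)
include hx

omit [NeZero n] in
/-- `N_x(i) ∈ {0, 1}` -/
lemma indicator_cases (i : ZMod n) : (1 - x i) / 2 = 0 ∨ (1 - x i) / 2 = 1 := by
  rcases hx i with h | h <;> rw [h] <;> norm_num

omit [NeZero n] in
/-- `x i = 1 − 2 N_x(i)` -/
lemma eq_one_sub_two_mul_indicator (i : ZMod n) : x i = 1 - 2 * ((1 - x i) / 2) := by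
  rcases hx i with h | h <;> rw [h] <;> norm_num

/-- **`PAF_x(s) = n − 4 K_x + 4 R_x(s)`** with `K_x = Σ N_x(i)`, `R_x(s) = Σ N_x(i) N_x(i + s)`. -/
lemma paf_eq_indicator (s : ZMod n) :
    PAF x s = n - 4 * ∑ i, (1 - x i) / 2 + 4 * ∑ i, (1 - x i) / 2 * ((1 - x (i + s)) / 2) := by
  have hpt : ∀ i, x i * x (i + s) =
      1 - 2 * ((1 - x i) / 2) - 2 * ((1 - x (i + s)) / 2) + 4 * ((1 - x i) / 2 * ((1 - x (i + s)) / 2)) := by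
    intro i
    rcases hx i with h | h <;> rcases hx (i + s) with h' | h' <;> rw [h, h'] <;> norm_num
  have hshift : ∑ i, (1 - x (i + s)) / 2 = ∑ i, (1 - x i) / 2 :=
    Equiv.sum_comp (Equiv.addRight s) (fun i => (1 - x i) / 2)
  unfold PAF
  rw [Finset.sum_congr rfl (fun i _ => hpt i)]
  simp only [Finset.sum_add_distrib, Finset.sum_sub_distrib, ← Finset.mul_sum, hshift, Finset.sum_const, Finset.card_univ,
    ZMod.card, nsmul_eq_mul, mul_one]
  ring

end indicator

section parity
variable {n : ℕ} [NeZero n]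

omit [NeZero n] in
/-- in `ℤ/n` with `n` odd, `a + a = 0 ↔ a = 0` (`2` is a unit) -/
lemma add_self_eq_zero_iff_of_odd (hn : Odd n) (a : ZMod n) : a + a = 0 ↔ a = 0 := by
  have hu : IsUnit (2 : ZMod n) := by
    have h := (ZMod.unitOfCoprime 2 (Nat.coprime_two_left.mpr hn)).isUnit
    rwa [ZMod.coe_unitOfCoprime, Nat.cast_ofNat] at h
  rw [← two_mul, hu.mul_right_eq_zero]

variable (x : ZMod n → ℤ) (hx : IsPM x) (hxs : ∀ i, x (-i) = x i)
include hxs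

/-- **`K_x ≡ N_x(0) (mod 2)`** for a symmetric sequence, `n` odd: the `−1` positions off `0` come in pairs `{i, −i}`. -/
lemma indicator_sum_cast (hn : Odd n) : ((∑ i, (1 - x i) / 2 : ℤ) : ZMod 2) = (((1 - x 0) / 2 : ℤ) : ZMod 2) := by
  rw [← Finset.add_sum_erase _ _ (Finset.mem_univ (0 : ZMod n)), Int.cast_add, Int.cast_sum]
  suffices hz : ∑ i ∈ (univ : Finset (ZMod n)).erase 0, (((1 - x i) / 2 : ℤ) : ZMod 2) = 0 by rw [hz, add_zero]
  refine Finset.sum_involution (fun i _ => -i) ?_ ?_ ?_ ?_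
  · intro i _
    rw [hxs i]
    exact CharTwo.add_self_eq_zero _
  · intro i hi _ heq
    have h0 : i + i = 0 := by nth_rewrite 1 [← heq]; exact neg_add_cancel i
    exact (Finset.mem_erase.mp hi).1 ((add_self_eq_zero_iff_of_odd hn i).mp h0)
  · intro i hi
    exact Finset.mem_erase.mpr ⟨neg_ne_zero.mpr (Finset.mem_erase.mp hi).1, Finset.mem_univ _⟩
  · intro i _
    exact neg_neg i

include hx in
/-- **`R_x(2h) ≡ N_x(h) (mod 2)`** for a symmetric sequence, `n` odd: the pairs `(i, i + 2h)` of `−1` positions are matched by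
`i ↦ −i − 2h`, whose only fixed point is `−h`. -/
lemma indicator_corr_cast (hn : Odd n) (h : ZMod n) :
    ((∑ i, (1 - x i) / 2 * ((1 - x (i + (h + h))) / 2) : ℤ) : ZMod 2) = (((1 - x h) / 2 : ℤ) : ZMod 2) := by
  rw [← Finset.add_sum_erase _ _ (Finset.mem_univ (-h : ZMod n)), Int.cast_add, Int.cast_sum]
  have hfix : (1 - x (-h)) / 2 * ((1 - x (-h + (h + h))) / 2) = (1 - x h) / 2 := by
    rw [show -h + (h + h) = h by abel, hxs h]
    rcases hx h with e | e <;> rw [e] <;> norm_num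
  rw [hfix]
  suffices hz : ∑ i ∈ (univ : Finset (ZMod n)).erase (-h),
      (((1 - x i) / 2 * ((1 - x (i + (h + h))) / 2) : ℤ) : ZMod 2) = 0 by rw [hz, add_zero]
  refine Finset.sum_involution (fun i _ => -i - (h + h)) ?_ ?_ ?_ ?_
  · intro i _
    have e1 : x (-i - (h + h)) = x (i + (h + h)) := by rw [show -i - (h + h) = -(i + (h + h)) by abel, hxs]
    have e2 : x (-i - (h + h) + (h + h)) = x i := by rw [show -i - (h + h) + (h + h) = -i by abel, hxs]
    rw [e1, e2, mul_comm (((1 - x (i + (h + h))) / 2 : ℤ)) ((1 - x i) / 2)]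
    exact CharTwo.add_self_eq_zero _
  · intro i hi _ heq
    have h0 : (i + h) + (i + h) = 0 := by linear_combination -heq
    exact (Finset.mem_erase.mp hi).1 (eq_neg_of_add_eq_zero_left ((add_self_eq_zero_iff_of_odd hn (i + h)).mp h0))
  · intro i hi
    refine Finset.mem_erase.mpr ⟨fun heq => (Finset.mem_erase.mp hi).1 ?_, Finset.mem_univ _⟩
    linear_combination -heq
  · intro i _
    abel

end parity

/-! ### a product of `±1` values is `−1` iff an odd number of them are `−1` -/

/-- for `0/1` values `p`, `Π (1 − 2p) = 1 − 2 (Σ p mod 2)` -/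
lemma prod_one_sub_two_mul (l : List ℤ) (hl : ∀ p ∈ l, p = 0 ∨ p = 1) :
    (l.map (fun p => 1 - 2 * p)).prod = 1 - 2 * (l.sum % 2) := by
  induction l with
  | nil => simp
  | cons p l ih =>
    rw [List.map_cons, List.prod_cons, List.sum_cons, ih (fun q hq => hl q (List.mem_cons_of_mem p hq))]
    rcases hl p (by simp) with rfl | rfl
    · simp
    · rcases Int.emod_two_eq_zero_or_one l.sum with h0 | h0
      · have h1 : (1 + l.sum) % 2 = 1 := by omega
        rw [h0, h1]; norm_num
      · have h1 : (1 + l.sum) % 2 = 0 := by omega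
        rw [h0, h1]; norm_num

/-! ### Williamson's theorem -/

section williamson
variable {n : ℕ} [NeZero n]

/-- **Williamson's product theorem** [Williamson 1944; Seberry–Yamada 2020, §3.2 Lemma 3.1].  For `n` odd and symmetric `±1`
sequences `a, b, c, d` on `ℤ/n` with `PAF_a(s) + PAF_b(s) + PAF_c(s) + PAF_d(s) = 0` for all `s ≠ 0` (Williamson sequences):
`a_s b_s c_s d_s = −(a_0 b_0 c_0 d_0)` for every `s ≠ 0` — after normalising `a_0 = b_0 = c_0 = d_0 = 1`, exactly three of
`a_s, b_s, c_s, d_s` have the same sign. -/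
theorem williamson_product_theorem (hn : Odd n) (a b c d : ZMod n → ℤ) (ha : IsPM a) (hb : IsPM b) (hc : IsPM c)
    (hd : IsPM d) (has : ∀ i, a (-i) = a i) (hbs : ∀ i, b (-i) = b i) (hcs : ∀ i, c (-i) = c i) (hds : ∀ i, d (-i) = d i)
    (hpaf : ∀ s : ZMod n, s ≠ 0 → PAF a s + PAF b s + PAF c s + PAF d s = 0) (s : ZMod n) (hs : s ≠ 0) :
    a s * b s * c s * d s = -(a 0 * b 0 * c 0 * d 0) := by
  -- the hypothesis at the shift `2s ≠ 0`
  have hs2 : s + s ≠ 0 := fun h0 => hs ((add_self_eq_zero_iff_of_odd hn s).mp h0)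
  have key := hpaf (s + s) hs2
  rw [paf_eq_indicator a ha, paf_eq_indicator b hb, paf_eq_indicator c hc, paf_eq_indicator d hd] at key
  have key' : (∑ i, (1 - a i) / 2 * ((1 - a (i + (s + s))) / 2)) + (∑ i, (1 - b i) / 2 * ((1 - b (i + (s + s))) / 2)) +
      (∑ i, (1 - c i) / 2 * ((1 - c (i + (s + s))) / 2)) + (∑ i, (1 - d i) / 2 * ((1 - d (i + (s + s))) / 2)) =
      (∑ i, (1 - a i) / 2) + (∑ i, (1 - b i) / 2) + (∑ i, (1 - c i) / 2) + (∑ i, (1 - d i) / 2) - n := by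
    linarith
  -- read modulo 2
  have hn2 : ((n : ℤ) : ZMod 2) = 1 := by rw [Int.cast_natCast]; exact ZMod.natCast_eq_one_iff_odd.mpr hn
  have kz := congrArg (Int.cast : ℤ → ZMod 2) key'
  simp only [Int.cast_add, Int.cast_sub] at kz
  rw [indicator_corr_cast a ha has hn s, indicator_corr_cast b hb hbs hn s, indicator_corr_cast c hc hcs hn s,
    indicator_corr_cast d hd hds hn s, indicator_sum_cast a has hn, indicator_sum_cast b hbs hn, indicator_sum_cast c hcs hn,
    indicator_sum_cast d hds hn, hn2] at kz
  -- back to an integer parity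
  have hdvd : (2 : ℤ) ∣ ((1 - a s) / 2 + (1 - b s) / 2 + (1 - c s) / 2 + (1 - d s) / 2 +
      ((1 - a 0) / 2 + (1 - b 0) / 2 + (1 - c 0) / 2 + (1 - d 0) / 2) - 1) := by
    apply (ZMod.intCast_zmod_eq_zero_iff_dvd _ 2).mp
    have h2 : (2 : ZMod 2) = 0 := by decide
    push_cast
    linear_combination kz + ((((1 - a 0) / 2 : ℤ) : ZMod 2) + (((1 - b 0) / 2 : ℤ) : ZMod 2) +
      (((1 - c 0) / 2 : ℤ) : ZMod 2) + (((1 - d 0) / 2 : ℤ) : ZMod 2) - 1) * h2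
  obtain ⟨q, hq⟩ := hdvd
  -- the product of the eight values `1 − 2N` is `−1`
  have hl := prod_one_sub_two_mul
    [(1 - a s) / 2, (1 - b s) / 2, (1 - c s) / 2, (1 - d s) / 2, (1 - a 0) / 2, (1 - b 0) / 2, (1 - c 0) / 2, (1 - d 0) / 2]
    (by
      intro p hp
      simp only [List.mem_cons, List.not_mem_nil, or_false] at hp
      rcases hp with rfl | rfl | rfl | rfl | rfl | rfl | rfl | rfl <;>
        first
          | exact indicator_cases a ha _ | exact indicator_cases b hb _ | exact indicator_cases c hc _
          | exact indicator_cases d hd _)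
  simp only [List.map_cons, List.map_nil, List.prod_cons, List.prod_nil, List.sum_cons, List.sum_nil, mul_one,
    add_zero] at hl
  have hmod : ((1 - a s) / 2 + ((1 - b s) / 2 + ((1 - c s) / 2 + ((1 - d s) / 2 + ((1 - a 0) / 2 + ((1 - b 0) / 2 +
      ((1 - c 0) / 2 + (1 - d 0) / 2))))))) % 2 = 1 := by omega
  rw [hmod, ← eq_one_sub_two_mul_indicator a ha s, ← eq_one_sub_two_mul_indicator b hb s,
    ← eq_one_sub_two_mul_indicator c hc s, ← eq_one_sub_two_mul_indicator d hd s, ← eq_one_sub_two_mul_indicator a ha 0,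
    ← eq_one_sub_two_mul_indicator b hb 0, ← eq_one_sub_two_mul_indicator c hc 0, ← eq_one_sub_two_mul_indicator d hd 0]
    at hl
  have hPQ : (a s * b s * c s * d s) * (a 0 * b 0 * c 0 * d 0) = -1 := by
    rw [show (a s * b s * c s * d s) * (a 0 * b 0 * c 0 * d 0) = a s * (b s * (c s * (d s * (a 0 * (b 0 * (c 0 * d 0))))))
      by ring, hl]
    norm_num
  have hQ : (a 0 * b 0 * c 0 * d 0) * (a 0 * b 0 * c 0 * d 0) = 1 := by
    rcases ha 0 with e1 | e1 <;> rcases hb 0 with e2 | e2 <;> rcases hc 0 with e3 | e3 <;> rcases hd 0 with e4 | e4 <;>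
      rw [e1, e2, e3, e4] <;> norm_num
  linear_combination (-(a s * b s * c s * d s)) * hQ + (a 0 * b 0 * c 0 * d 0) * hPQ

/-- **Williamson's theorem, normalised form**: if moreover `a_0 = b_0 = c_0 = d_0 = 1` then `a_s b_s c_s d_s = −1` for all
`s ≠ 0` (exactly three of the four signs agree). -/
theorem williamson_product_normalised (hn : Odd n) (a b c d : ZMod n → ℤ) (ha : IsPM a) (hb : IsPM b) (hc : IsPM c)
    (hd : IsPM d) (has : ∀ i, a (-i) = a i) (hbs : ∀ i, b (-i) = b i) (hcs : ∀ i, c (-i) = c i) (hds : ∀ i, d (-i) = d i)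
    (hpaf : ∀ s : ZMod n, s ≠ 0 → PAF a s + PAF b s + PAF c s + PAF d s = 0)
    (ha0 : a 0 = 1) (hb0 : b 0 = 1) (hc0 : c 0 = 1) (hd0 : d 0 = 1) (s : ZMod n) (hs : s ≠ 0) :
    a s * b s * c s * d s = -1 := by
  rw [williamson_product_theorem hn a b c d ha hb hc hd has hbs hcs hds hpaf s hs, ha0, hb0, hc0, hd0]
  norm_num

/-! ### normalisation: replacing a sequence by its negative -/

omit [NeZero n] in
/-- negating a `±1` sequence keeps it `±1` -/
lemma isPM_neg_mul (x : ZMod n → ℤ) (hx : IsPM x) (ε : ℤ) (hε : ε = 1 ∨ ε = -1) : IsPM (fun i => ε * x i) := by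
  intro i
  show ε * x i = 1 ∨ ε * x i = -1
  rcases hx i with h | h <;> rcases hε with rfl | rfl <;> rw [h] <;> norm_num

/-- scaling by `ε = ±1` does not change the periodic autocorrelation -/
lemma paf_neg_mul (x : ZMod n → ℤ) (ε : ℤ) (hε : ε = 1 ∨ ε = -1) (s : ZMod n) : PAF (fun i => ε * x i) s = PAF x s := by
  unfold PAF
  refine Finset.sum_congr rfl (fun i _ => ?_)
  rcases hε with rfl | rfl <;> ring

/-- **Normalisation.**  Williamson sequences can be normalised to `a_0 = b_0 = c_0 = d_0 = 1` (multiply each sequence by its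
value at `0`); for odd `n` the normalised sequences satisfy Williamson's product condition `a_s b_s c_s d_s = −1`, `s ≠ 0`. -/
theorem williamsonSequences_normalise (hn : Odd n) (a b c d : ZMod n → ℤ) (ha : IsPM a) (hb : IsPM b) (hc : IsPM c)
    (hd : IsPM d) (has : ∀ i, a (-i) = a i) (hbs : ∀ i, b (-i) = b i) (hcs : ∀ i, c (-i) = c i) (hds : ∀ i, d (-i) = d i)
    (hpaf : ∀ s : ZMod n, s ≠ 0 → PAF a s + PAF b s + PAF c s + PAF d s = 0) :
    ∃ a' b' c' d' : ZMod n → ℤ, IsPM a' ∧ IsPM b' ∧ IsPM c' ∧ IsPM d' ∧ (∀ i, a' (-i) = a' i) ∧ (∀ i, b' (-i) = b' i) ∧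
      (∀ i, c' (-i) = c' i) ∧ (∀ i, d' (-i) = d' i) ∧ (∀ s : ZMod n, s ≠ 0 → PAF a' s + PAF b' s + PAF c' s + PAF d' s = 0) ∧
      a' 0 = 1 ∧ b' 0 = 1 ∧ c' 0 = 1 ∧ d' 0 = 1 ∧ ∀ s : ZMod n, s ≠ 0 → a' s * b' s * c' s * d' s = -1 := by
  have hsq : ∀ (x : ZMod n → ℤ), IsPM x → x 0 * x 0 = 1 := fun x hx => by
    rcases hx 0 with h | h <;> rw [h] <;> norm_num
  have hpaf' : ∀ s : ZMod n, s ≠ 0 → PAF (fun i => a 0 * a i) s + PAF (fun i => b 0 * b i) s +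
      PAF (fun i => c 0 * c i) s + PAF (fun i => d 0 * d i) s = 0 := fun s hs => by
    rw [paf_neg_mul a _ (ha 0), paf_neg_mul b _ (hb 0), paf_neg_mul c _ (hc 0), paf_neg_mul d _ (hd 0)]
    exact hpaf s hs
  refine ⟨fun i => a 0 * a i, fun i => b 0 * b i, fun i => c 0 * c i, fun i => d 0 * d i,
    isPM_neg_mul a ha _ (ha 0), isPM_neg_mul b hb _ (hb 0), isPM_neg_mul c hc _ (hc 0), isPM_neg_mul d hd _ (hd 0),
    fun i => by simp only [has], fun i => by simp only [hbs], fun i => by simp only [hcs], fun i => by simp only [hds],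
    hpaf', hsq a ha, hsq b hb, hsq c hc, hsq d hd, fun s hs => ?_⟩
  exact williamson_product_normalised hn _ _ _ _ (isPM_neg_mul a ha _ (ha 0)) (isPM_neg_mul b hb _ (hb 0))
    (isPM_neg_mul c hc _ (hc 0)) (isPM_neg_mul d hd _ (hd 0)) (fun i => by simp only [has]) (fun i => by simp only [hbs])
    (fun i => by simp only [hcs]) (fun i => by simp only [hds]) hpaf' (hsq a ha) (hsq b hb) (hsq c hc) (hsq d hd) s hs

end williamson

/-! ### the classical-Williamson census line at 668, normalised -/

/-- **H(668): `|N(⟨σ₁₆₇⟩):±⟨σ₁₆₇⟩| = 8` ⇒ NORMALISED Williamson sequences of length 167 with Williamson's product condition.**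
If some Hadamard matrix of order `668` has a signed automorphism `σ` of pair exponent `167` with an index-`4` centraliser and an
inverting automorphism (gen 22's hypothesis), then there are symmetric `±1` sequences `a, b, c, d` on `ℤ/167` with
`Σ PAF = 0` off `0`, `a_0 = b_0 = c_0 = d_0 = 1` and `a_s b_s c_s d_s = −1` for all `s ≠ 0` — the object of every Williamson
search since Baumert–Hall (open at length 167). -/
theorem hadamard668_normalizer_index_eight_williamson_normalised
    (hyp : ∃ (ι : Type) (_ : Fintype ι) (_ : DecidableEq ι) (H : Matrix ι ι ℤ) (π κ π₁ κ₁ π₂ κ₂ π' κ' : Equiv.Perm ι)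
        (d e d₁ e₁ d₂ e₂ d' e' : ι → ℤ) (μ : ℕ), Fintype.card ι = 668 ∧ IsHadamardMatrix H ∧ IsSignedAut H π κ d e ∧
        π ^ 167 = 1 ∧ κ ^ 167 = 1 ∧ (π ≠ 1 ∨ κ ≠ 1) ∧ IsSignedAut H π₁ κ₁ d₁ e₁ ∧ IsSignedAut H π₂ κ₂ d₂ e₂ ∧
        Commute π₁ π ∧ Commute κ₁ κ ∧ Commute π₂ π ∧ Commute κ₂ κ ∧ π₁ ^ 2 = 1 ∧ κ₁ ^ 2 = 1 ∧ π₂ ^ 2 = 1 ∧ κ₂ ^ 2 = 1 ∧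
        (π₁ ≠ 1 ∨ κ₁ ≠ 1) ∧ (π₂ ≠ 1 ∨ κ₂ ≠ 1) ∧ (π₁ ≠ π₂ ∨ κ₁ ≠ κ₂) ∧ IsSignedAut H π' κ' d' e' ∧
        π' * π = π ^ μ * π' ∧ κ' * κ = κ ^ μ * κ' ∧ μ % 167 = 166) :
    ∃ a b c d : ZMod 167 → ℤ, IsPM a ∧ IsPM b ∧ IsPM c ∧ IsPM d ∧ (∀ i, a (-i) = a i) ∧ (∀ i, b (-i) = b i) ∧
      (∀ i, c (-i) = c i) ∧ (∀ i, d (-i) = d i) ∧ (∀ s : ZMod 167, s ≠ 0 → PAF a s + PAF b s + PAF c s + PAF d s = 0) ∧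
      a 0 = 1 ∧ b 0 = 1 ∧ c 0 = 1 ∧ d 0 = 1 ∧ ∀ s : ZMod 167, s ≠ 0 → a s * b s * c s * d s = -1 := by
  obtain ⟨a, b, c, d, ha, hb, hc, hd, has, hbs, hcs, hds, hpaf⟩ :=
    hadamard668_normalizer_index_eight_iff_williamsonSequences.mp hyp
  exact williamsonSequences_normalise ⟨83, by norm_num⟩ a b c d ha hb hc hd has hbs hcs hds hpaf

end Summit.Ventures.DiscreteObjects.Hadamard
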